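import Summits.QuantumFields.BalabanUV.T4Continuum.Support.VariationalHarmonicApprox
import Summits.QuantumFields.BalabanUV.T4Continuum.Support.VariationalInterpolantSharp
import Summits.QuantumFields.BalabanUV.T4Continuum.Support.VariationalCovariantAssembly
import Summits.QuantumFields.BalabanUV.T4Continuum.Support.VariationalColourLipschitzRepair

/-!
# T⁴ programme, spine node NE2 (U1a), lane P2 — «V-ONE-G»: BAŁABAN's FINE PROJECTED GAUGE FUNCTIONAL OF AN INTERPOLANT AGAINST THE COARSE ONE, REDUCED TO
# ONE DISPLAYED LATTICE ESTIMATE (DIV-INTERP) — the slice-complement terms DISCHARGED by HARM-APPROX and the centred interpolant's sharp size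
# (item «V-ONE-G WITH BACKGROUND», file 3b; model level; cell `pub-balaban`)

NE2 formalisation swarm `b2b-balaban-t4-ne2-formalise-*`, leaf prover 01 GEN 8 (`prover-b2b-balaban-t4-ne2-formalise-leaf-01-g8-0`); journal INTENT
CLAIMS.log 2026-08-20 l.18200, FINDING F-ne2leaf01g8-1 l.18526, memo `t4/T4-EST-NE2-P2-VONEG.md` v1 §4.  Files 1–2 of the item: `VariationalVectorGaugeSliceDist`
(`projG = dist²` to the slice complement; the complement = scalar fibre-minimisers; (ONE-min) ⇐ (C)₀ ∧ (G′)), `VariationalHarmonicApprox` (HARM-APPROX from the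
colour sector's one-step brackets).

WHAT.  For the coarse data (`Rc`, `T`; `K = ker Q_T`, `G = projG Rc K`) and the fine data (`R′`, `T′`; the COMPOSITE constraint map
`Φ = Q_T ∘ Q_{T′}`, `K′ = ker Φ`, `G′ = projG R′ K′`) and ANY competitor map `J` on 1-forms, with `J₀ := interpv T′ Rc` the colour sector's centred one-step
interpolant of 0-forms:
 * (file 3a `VariationalInterpolantSharp`: `nsqv_interpv_le_sharp` — `Σ_x‖J₀ v (x)‖² ≤ L^d·Σ_y‖v y‖² + (d∕4)·L^d·Σ_{y,μ}‖(D_μ v)(y)‖²`, coefficient ONE on the mass);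
 * §2 **`sqrt_projG_le`** («V-ONE-G», square-root shape, lattice units): with `s₀ := Π_{Sᗮ}(div_{Rc} W)` (a coarse scalar minimiser, file 1) and the fine scalar minimiser
   `u′` of the same unit datum (exists by coercivity = the displayed fine P⁺, `exists_isMinOn_fib`),
   `√(projG′ (J W)) ≤ √(Σ‖div′(JW) − L⁻¹J₀(div W)‖²) + L^{d∕2−1}·(√(G W) + (√d∕2)·√(Σ‖D(div W − s₀)‖²)) + L⁻¹·√(nsqv(J₀ s₀ − u′))`
   — three-term Minkowski in `ℓ²` against the element `L⁻¹u′ ∈ S′ᗮ` (file 2's `projG_le_nsqv_sub_of_isMin_linear`);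
 * §3 **`sqrt_oneG_le`** ∕ **`oneG_le_add`** (END units): the third term is HARM-APPROX (file 2's `harmApprox_colour`: `≤ C_P e_H·nsqv ψ₀`, and `n²·nsqv ψ₀ ≤ n^{2−d}·Σ‖s₀‖² ≤
   n^{2−d}·divSq W` for unitary `T`), so that
   `((nL)^d)⁻¹(nL)²·G′(J W) ≤ (√((n^d)⁻¹n²·G W) + √(ε_G·ρ_G W))²`,  `ε_G·ρ_G W := 3·(L^{2−d}·(n^d)⁻¹n²·DIV(W) + (d∕4)(n^d)⁻¹n²·Σ‖D(div W − s₀)‖² + C_P e_H·(n^d)⁻¹n²·divSq W)`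
   with DIV(W) the ONE displayed lattice quantity `Σ‖div′(JW) − L⁻¹J₀(div W)‖²` (DIV-INTERP, OPEN; numerically ∝ L^{−2k} for the componentwise centred `J`,
   memo VONEG §2) and UB⁺∕P⁺∕REG⁺ of the scalar pair displayed as in file 2.  The additive (G′) shape of file 1 follows by `(√a + √b)² ≤ (1+t)a + (1+t⁻¹)b`.

HONEST FRAMING (T4-DAG p. 1).  Lattice bookkeeping + composition at MODEL level (transports ∕ site operators ∕ `J` DATA, c5); [folklore]; nothing printed is a
hypothesis; no `def`, no `def … : Prop`, no `sorry`; axioms standard.  DIV-INTERP and the scalar UB⁺∕P⁺∕REG⁺ are DISPLAYED; V-ONE-G ∕ (ONE-min) with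
background NOT proved unconditionally; V-END with background ∕ NE2 NOT proved; NE3 OPEN; spine PROVED 0∕9 unchanged; rung (B)+1 on a fixed finite T⁴ — NOT
infinite volume, NOT mass gap, NOT Clay.  HONEST DEPENDENCY (cell, verbatim): continuum YM on T⁴ ⇐ BetaPertH ∧ nine spine estimates (0/9 proved); BetaPertH ⇐
(D1) ∧ (D4) ∧ CAP+tail; G-an2-4 gates asym, D1 and NE2/3/4.
-/

noncomputable section

namespace Summit.QuantumFields.BalabanUV.T4Continuum.VariationalVectorOneG

open Finset WithLp
open scoped InnerProductSpace
open Literature.MathematicalPhysics.QuantumFieldTheory.Balaban1983to89.B5Prop11Plancherel (Tor fine unitVec)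
open Literature.MathematicalPhysics.QuantumFieldTheory.Balaban1983to89.B5Block118 (bpt)
open Literature.MathematicalPhysics.QuantumFieldTheory.Balaban1983to89.B5AverageCurlStokes (sum_blocks_real)
open Summit.QuantumFields.BalabanUV.T4Continuum.VariationalColourFederbush (cDv dirUv dirUv_nonneg Qcv misv norm_le_one_of_mem_unitary)
open Summit.QuantumFields.BalabanUV.T4Continuum.VariationalColourUpperBound (nsqv nsqv_nonneg)
open Summit.QuantumFields.BalabanUV.T4Continuum.VariationalCovariantWeights (wt abs_wt_le sum_wt_coord)
open Summit.QuantumFields.BalabanUV.T4Continuum.VariationalColourInterpolant (Phiv PhiFv interpv interpv_bpt Qcv_interpv norm_star_apply_le)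
open Summit.QuantumFields.BalabanUV.T4Continuum.VariationalColourOneStepPhys (rhov rhov_nonneg)
open Summit.QuantumFields.BalabanUV.T4Continuum.VariationalColourScalarPair (Scv Sfv qWv qVv Qkv Q1v Scv_nonneg Sfv_nonneg qWv_nonneg qVv_nonneg)
open Summit.QuantumFields.BalabanUV.T4Continuum.VariationalVectorWeitzenbock (divV divSq divSq_nonneg)
open Summit.QuantumFields.BalabanUV.T4Continuum.VariationalVectorGaugeSlice (sliceSub projG projG_nonneg avgOp avgOp_apply norm_toLp_sq)
open Summit.QuantumFields.BalabanUV.T4Continuum.VariationalVectorGaugeSliceDist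
  (projG_eq_norm_sub_sq starProjection_orthogonal_mem isMin_starProjection_orthogonal norm_toLp_sub_sq)
open Summit.QuantumFields.BalabanUV.T4Continuum.VariationalHarmonicApprox (projG_le_nsqv_sub_of_isMin_linear harmApprox_colour Qkv_Q1v_sub)
open Summit.QuantumFields.BalabanUV.T4Continuum.VariationalCovariantAssembly (exists_isMinOn_fib)
open Summit.QuantumFields.BalabanUV.T4Continuum.VariationalInterpolantSharp (nsqv_interpv_le_sharp interpv_sub norm_toLp_interpv_le)

variable {d : ℕ} {E : Type*} [NormedAddCommGroup E] [InnerProductSpace ℂ E] [CompleteSpace E] [FiniteDimensional ℂ E]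

/-! ## §2 «V-ONE-G» in square-root shape, lattice units: three-term Minkowski against `L⁻¹u′ ∈ S′ᗮ` -/

section OneG

variable (n L : ℕ) [NeZero n] [NeZero L] (M : Fin d → ℕ) [hM : ∀ μ, NeZero (M μ)]

/-- **V-ONE-G, SQUARE-ROOT SHAPE (lattice units)**: coarse data (`Rc`, `T`, `K = ker Q_T`), fine data (`R′`, `T′`, `K′ = ker(Q_T ∘ Q_{T′})`), any fine 1-form `V`
(think `V = J W`), `s₀ := Π_{Sᗮ}(div_{Rc} W)` read as a 0-form, `u′` a fine minimiser of the scalar Dirichlet sum on the composite fibre of `Q_T s₀`: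
`√(projG′ V) ≤ ‖div′ V − L⁻¹J₀(div W)‖ + L⁻¹√(L^d)·(√(projG W) + (√d∕2)·‖D(div W − s₀)‖) + L⁻¹‖J₀ s₀ − u′‖` (`J₀ = interpv T′ Rc`). [folklore] -/
theorem sqrt_projG_le {Rc : Tor (fine n M) → Fin d → (E →L[ℂ] E)} {T : Tor (fine n M) → (E →L[ℂ] E)}
    {R' : Tor (fine L (fine n M)) → Fin d → (E →L[ℂ] E)} {T' : Tor (fine L (fine n M)) → (E →L[ℂ] E)} (hT' : ∀ x, T' x ∈ unitary (E →L[ℂ] E))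
    (W : Tor (fine n M) → Fin d → E) (V : Tor (fine L (fine n M)) → Fin d → E)
    {u' : Tor (fine L (fine n M)) → E}
    (hu'min : ∀ g, (avgOp n M T).comp (avgOp L (fine n M) T') g = (avgOp n M T).comp (avgOp L (fine n M) T') u' →
      ∑ ν, dirUv (fine L (fine n M)) R' u' ν ≤ ∑ ν, dirUv (fine L (fine n M)) R' g ν) :
    let s₀ : Tor (fine n M) → E := WithLp.ofLp ((sliceSub (fine n M) Rc (LinearMap.ker (avgOp n M T)))ᗮ.starProjection (toLp 2 (divV (fine n M) Rc W)))
    Real.sqrt (projG (fine L (fine n M)) R' (LinearMap.ker ((avgOp n M T).comp (avgOp L (fine n M) T'))) V)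
      ≤ Real.sqrt (∑ x, ‖divV (fine L (fine n M)) R' V x - ((L : ℂ))⁻¹ • interpv L (fine n M) T' Rc (divV (fine n M) Rc W) x‖ ^ 2)
        + ((L : ℝ))⁻¹ * (Real.sqrt ((L : ℝ) ^ d) * (Real.sqrt (projG (fine n M) Rc (LinearMap.ker (avgOp n M T)) W)
            + Real.sqrt ((d : ℝ) / 4) * Real.sqrt (∑ y, ∑ μ, ‖cDv (fine n M) Rc (divV (fine n M) Rc W - s₀) y μ‖ ^ 2)))
        + ((L : ℝ))⁻¹ * Real.sqrt (∑ x, ‖interpv L (fine n M) T' Rc s₀ x - u' x‖ ^ 2) := by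
  intro s₀
  set Φ := (avgOp n M T).comp (avgOp L (fine n M) T') with hΦ
  set J₀ := interpv L (fine n M) T' Rc with hJ₀
  have hL0 : (0 : ℝ) < L := by exact_mod_cast Nat.pos_of_ne_zero (NeZero.ne L)
  -- `u′ ∈ S′ᗮ`, hence `L⁻¹•u′ ∈ S′ᗮ`
  have hu'mem : toLp 2 u' ∈ (sliceSub (fine L (fine n M)) R' (LinearMap.ker Φ))ᗮ :=
    (VariationalHarmonicApprox.toLp_mem_orthogonal_iff_isMin_linear R' Φ u').mpr fun g hg => hu'min g hg
  have hsmem : ((L : ℂ))⁻¹ • toLp 2 u' ∈ (sliceSub (fine L (fine n M)) R' (LinearMap.ker Φ))ᗮ := Submodule.smul_mem _ _ hu'mem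
  -- projG′ V ≤ ‖toLp(div′V) − L⁻¹•toLp u′‖²
  have h1 : projG (fine L (fine n M)) R' (LinearMap.ker Φ) V ≤ ‖toLp 2 (divV (fine L (fine n M)) R' V) - ((L : ℂ))⁻¹ • toLp 2 u'‖ ^ 2 :=
    VariationalVectorGaugeSliceDist.projG_le_norm_sub_sq (fine L (fine n M)) R' _ V hsmem
  have h1' : Real.sqrt (projG (fine L (fine n M)) R' (LinearMap.ker Φ) V) ≤ ‖toLp 2 (divV (fine L (fine n M)) R' V) - ((L : ℂ))⁻¹ • toLp 2 u'‖ := by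
    rw [← Real.sqrt_sq (norm_nonneg (toLp 2 (divV (fine L (fine n M)) R' V) - ((L : ℂ))⁻¹ • toLp 2 u'))]
    exact Real.sqrt_le_sqrt h1
  -- the three-term split in `ℓ²`
  have hsplit : toLp 2 (divV (fine L (fine n M)) R' V) - ((L : ℂ))⁻¹ • toLp 2 u'
      = (toLp 2 (divV (fine L (fine n M)) R' V) - ((L : ℂ))⁻¹ • toLp 2 (J₀ (divV (fine n M) Rc W)))
        + ((L : ℂ))⁻¹ • toLp 2 (J₀ (divV (fine n M) Rc W - s₀))
        + ((L : ℂ))⁻¹ • (toLp 2 (J₀ s₀) - toLp 2 u') := by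
    rw [hJ₀, interpv_sub, toLp_sub, smul_sub, smul_sub]
    abel
  have hnL : ‖((L : ℂ))⁻¹‖ = ((L : ℝ))⁻¹ := by rw [norm_inv, Complex.norm_natCast]
  -- term 1 and term 3 read in the function world
  have ht1 : ‖toLp 2 (divV (fine L (fine n M)) R' V) - ((L : ℂ))⁻¹ • toLp 2 (J₀ (divV (fine n M) Rc W))‖
      = Real.sqrt (∑ x, ‖divV (fine L (fine n M)) R' V x - ((L : ℂ))⁻¹ • J₀ (divV (fine n M) Rc W) x‖ ^ 2) := by
    rw [← toLp_smul, ← Real.sqrt_sq (norm_nonneg _), VariationalVectorGaugeSliceDist.norm_toLp_sub_sq]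
    rfl
  have ht3 : ‖toLp 2 (J₀ s₀) - toLp 2 u'‖ = Real.sqrt (∑ x, ‖J₀ s₀ x - u' x‖ ^ 2) := by
    rw [← Real.sqrt_sq (norm_nonneg _), VariationalVectorGaugeSliceDist.norm_toLp_sub_sq]
  -- term 2: the sharp interpolant size, with `Σ‖div W − s₀‖² = projG W`
  have hG : ∑ y, ‖(divV (fine n M) Rc W - s₀) y‖ ^ 2 = projG (fine n M) Rc (LinearMap.ker (avgOp n M T)) W := by
    simp only [Pi.sub_apply]
    rw [VariationalVectorGaugeSliceDist.projG_eq_norm_sub_sq, ← VariationalVectorGaugeSliceDist.norm_toLp_sub_sq (fine n M)]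
  have ht2 : ‖toLp 2 (J₀ (divV (fine n M) Rc W - s₀))‖
      ≤ Real.sqrt ((L : ℝ) ^ d) * (Real.sqrt (projG (fine n M) Rc (LinearMap.ker (avgOp n M T)) W)
          + Real.sqrt ((d : ℝ) / 4) * Real.sqrt (∑ y, ∑ μ, ‖cDv (fine n M) Rc (divV (fine n M) Rc W - s₀) y μ‖ ^ 2)) := by
    have h := norm_toLp_interpv_le L (fine n M) hT' Rc (divV (fine n M) Rc W - s₀)
    rw [hG] at h
    exact h
  calc Real.sqrt (projG (fine L (fine n M)) R' (LinearMap.ker Φ) V)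
      ≤ ‖toLp 2 (divV (fine L (fine n M)) R' V) - ((L : ℂ))⁻¹ • toLp 2 u'‖ := h1'
    _ ≤ ‖toLp 2 (divV (fine L (fine n M)) R' V) - ((L : ℂ))⁻¹ • toLp 2 (J₀ (divV (fine n M) Rc W))‖
        + ‖((L : ℂ))⁻¹ • toLp 2 (J₀ (divV (fine n M) Rc W - s₀))‖ + ‖((L : ℂ))⁻¹ • (toLp 2 (J₀ s₀) - toLp 2 u')‖ := by
        rw [hsplit]; exact norm_add₃_le
    _ ≤ _ := by
        rw [norm_smul, norm_smul, hnL, ht1, ht3]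
        refine add_le_add (add_le_add le_rfl (mul_le_mul_of_nonneg_left ht2 (by positivity))) le_rfl


/-! ## §3 END units: the third term DISCHARGED by HARM-APPROX (file 2), the datum size by the projection's contraction -/

omit [CompleteSpace E] [FiniteDimensional ℂ E] [NeZero L] in
/-- the transported block average of a field is no larger than the field in `ℓ²` per block: `nsqv (Qkv T s) ≤ qWv s` for contractive site operators
(leaf-02-g6's block Cauchy–Schwarz `nsqv_Qkv_sub_Qkv_le` against the zero operators). [folklore] -/
theorem nsqv_Qkv_le {T : Tor (fine n M) → (E →L[ℂ] E)} (hT : ∀ x, ‖T x‖ ≤ 1) (s : Tor (fine n M) → E) :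
    nsqv (Qkv n M T s) ≤ qWv n M s := by
  have h := VariationalColourLipschitzRepair.nsqv_Qkv_sub_Qkv_le n M (T := fun _ => (0 : E →L[ℂ] E)) (T' := T) (τ := 1)
    (fun x => by simpa using hT x) s
  have h0 : Qkv n M (fun _ => (0 : E →L[ℂ] E)) s = 0 := by funext z; simp [Qkv, Qcv]
  rw [h0, sub_zero, one_pow, one_mul] at h
  exact h

/-- **V-ONE-G IN END UNITS, SQUARE-ROOT SHAPE, HARM-APPROX DISCHARGED** (model level; `E` a finite-dimensional Hilbert space): under the one-step data of the colour
pair (unitary `T`, `T′`, `Rc`; contractive `R′`; mismatch `m`; frame defects `m₁`) and its displayed leaves UB⁺ ∕ P⁺ (both levels) ∕ REG⁺, for every coarse 1-form `W`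
and every fine 1-form `V` (think `V = J W`):
`√(c_f·G′ V) ≤ √(c_f·DIV) + √(c_c·G W) + (√d∕2)·√(c_c·Σ‖D(div W − s₀)‖²) + √(C_P·e_H·c_c·divSq W)`,
`c_f = ((nL)^d)⁻¹(nL)²`, `c_c = (n^d)⁻¹n²`, `DIV = Σ_x‖div′V x − L⁻¹(J₀ div W) x‖²` (DIV-INTERP's quantity, DISPLAYED as a raw term), `s₀ = Π_{Sᗮ}(div W)`,
`e_H` = file 2's HARM-APPROX constant.  The fine scalar minimiser is produced by compactness (`exists_isMinOn_fib` on the displayed fine P⁺). [folklore] -/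
theorem sqrt_oneG_le {Rc : Tor (fine n M) → Fin d → (E →L[ℂ] E)} {R' : Tor (fine L (fine n M)) → Fin d → (E →L[ℂ] E)}
    {T : Tor (fine n M) → (E →L[ℂ] E)} {T' : Tor (fine L (fine n M)) → (E →L[ℂ] E)}
    (hT : ∀ x, T x ∈ unitary (E →L[ℂ] E)) (hT' : ∀ x, T' x ∈ unitary (E →L[ℂ] E)) (hRc : ∀ y μ, Rc y μ ∈ unitary (E →L[ℂ] E))
    (hR' : ∀ x μ, ‖R' x μ‖ ≤ 1)
    {m : ℝ} (hm : 0 ≤ m) (hmis : ∀ y μ j, ‖misv L (fine n M) Rc R' T' y μ j‖ ≤ m)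
    {m₁ : ℝ} (hm₁ : 0 ≤ m₁)
    (hin : ∀ (y : Tor (fine n M)) (j : Fin d → Fin L) (μ : Fin d), (j μ : ℕ) + 1 < L →
      ‖R' (bpt L (fine n M) y j) μ * star (T' (bpt L (fine n M) y j + unitVec (fine L (fine n M)) μ)) - star (T' (bpt L (fine n M) y j))‖ ≤ m₁)
    (hcross : ∀ (y : Tor (fine n M)) (j : Fin d → Fin L) (μ : Fin d), (j μ : ℕ) + 1 = L →
      ‖R' (bpt L (fine n M) y j) μ * star (T' (bpt L (fine n M) y j + unitVec (fine L (fine n M)) μ))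
        - star (T' (bpt L (fine n M) y j)) * Rc y μ‖ ≤ m₁)
    {Λ CP CR : ℝ} (hΛ : 0 ≤ Λ) (hCP : 0 ≤ CP) (hCR : 0 ≤ CR)
    (hUBc : ∀ ψ : Tor M → E, ∃ f, Qkv n M T f = ψ ∧ Scv n M Rc f ≤ Λ * nsqv ψ)
    (hUBf : ∀ ψ : Tor M → E, ∃ g, Qkv n M T (Q1v n L M T' g) = ψ ∧ Sfv n L M R' g ≤ Λ * nsqv ψ)
    (hPc : ∀ f, qWv n M f ≤ CP * (Scv n M Rc f + nsqv (Qkv n M T f)))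
    (hPf : ∀ g, qVv n L M g ≤ CP * (Sfv n L M R' g + nsqv (Qkv n M T (Q1v n L M T' g))))
    (hREG : ∀ (ψ : Tor M → E) f, Qkv n M T f = ψ → (∀ f₂, Qkv n M T f₂ = ψ → Scv n M Rc f ≤ Scv n M Rc f₂) →
      rhov n M Rc f ≤ CR * (Scv n M Rc f + nsqv ψ))
    (W : Tor (fine n M) → Fin d → E) (V : Tor (fine L (fine n M)) → Fin d → E) :
    let ε₁ : ℝ := ((d : ℝ) / 4 + 1 / 2) * ((L : ℝ) / (n : ℝ) ^ 2)
    let δ' : ℝ := Real.sqrt (2 * d * (1 + (d : ℝ) ^ 2)) * ((n : ℝ) * L * m₁)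
    let δ : ℝ := Real.sqrt d * ((n : ℝ) * m)
    let eH : ℝ := ε₁ * CR * (Λ + 1) + 2 * δ' * Real.sqrt ((Λ + ε₁ * CR * (Λ + 1)) * (CP * (Λ + 1))) + δ' ^ 2 * (CP * (Λ + 1))
      + 2 * δ * Real.sqrt (Λ * (CP * (Λ + 1)))
    let s₀ : Tor (fine n M) → E := WithLp.ofLp ((sliceSub (fine n M) Rc (LinearMap.ker (avgOp n M T)))ᗮ.starProjection (toLp 2 (divV (fine n M) Rc W)))
    let cf : ℝ := (((n : ℝ) * L) ^ d)⁻¹ * ((n : ℝ) * L) ^ 2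
    let cc : ℝ := ((n : ℝ) ^ d)⁻¹ * (n : ℝ) ^ 2
    Real.sqrt (cf * projG (fine L (fine n M)) R' (LinearMap.ker ((avgOp n M T).comp (avgOp L (fine n M) T'))) V)
      ≤ Real.sqrt (cf * ∑ x, ‖divV (fine L (fine n M)) R' V x - ((L : ℂ))⁻¹ • interpv L (fine n M) T' Rc (divV (fine n M) Rc W) x‖ ^ 2)
        + Real.sqrt (cc * projG (fine n M) Rc (LinearMap.ker (avgOp n M T)) W)
        + Real.sqrt ((d : ℝ) / 4) * Real.sqrt (cc * ∑ y, ∑ μ, ‖cDv (fine n M) Rc (divV (fine n M) Rc W - s₀) y μ‖ ^ 2)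
        + Real.sqrt (CP * eH * (cc * divSq (fine n M) Rc W)) := by
  intro ε₁ δ' δ eH s₀ cf cc
  have hn0 : (0 : ℝ) < n := by exact_mod_cast Nat.pos_of_ne_zero (NeZero.ne n)
  have hL0 : (0 : ℝ) < L := by exact_mod_cast Nat.pos_of_ne_zero (NeZero.ne L)
  have hcf : 0 ≤ cf := by positivity
  have hcc : 0 ≤ cc := by positivity
  have hcS : 0 < ((n : ℝ) * L) ^ 2 / ((n : ℝ) * L) ^ d := by positivity
  have hcS' : 0 < (n : ℝ) ^ 2 / (n : ℝ) ^ d := by positivity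
  -- the datum of `s₀` and the interpolant `j` in the composite fibre
  set ψ₀ : Tor M → E := Qkv n M T s₀ with hψ₀
  set j := interpv L (fine n M) T' Rc s₀ with hjdef
  have hQ1j : Q1v n L M T' j = s₀ := Qcv_interpv L (fine n M) Rc s₀ hT'
  have hj : Qkv n M T (Q1v n L M T' j) = ψ₀ := by rw [hQ1j]
  -- `s₀` minimises `Scv` on its own fibre (file 1)
  have hsmin : ∀ f₂, Qkv n M T f₂ = ψ₀ → Scv n M Rc s₀ ≤ Scv n M Rc f₂ := by
    intro f₂ hf₂
    have h := isMin_starProjection_orthogonal n M T Rc (toLp 2 (divV (fine n M) Rc W)) f₂ hf₂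
    unfold Scv
    exact mul_le_mul_of_nonneg_left h hcS'.le
  -- a fine minimiser `u′` on the composite fibre of `ψ₀`, by compactness from the displayed fine P⁺
  have hQc : Continuous fun g : Tor (fine L (fine n M)) → E => Qkv n M T (Q1v n L M T' g) :=
    ((avgOp n M T).comp (avgOp L (fine n M) T')).continuous_of_finiteDimensional
  have hSc : Continuous (Sfv n L M R') :=
    VariationalColourScalarPair.continuous_sum_dirUv R' (((n : ℝ) * L) ^ 2 / ((n : ℝ) * L) ^ d)
  obtain ⟨u', hu', hu'min⟩ := exists_isMinOn_fib (Q := fun g : Tor (fine L (fine n M)) → E => Qkv n M T (Q1v n L M T' g))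
    hQc (S := Sfv n L M R') hSc (q := qVv n L M) (qZ := nsqv) (κ := ((n : ℝ) * L) ^ d) (C := CP) (by positivity) hCP
    (VariationalColourScalarPair.norm_sq_le_qVv n L M) hPf hj
  have hu'min' : ∀ g, (avgOp n M T).comp (avgOp L (fine n M) T') g = (avgOp n M T).comp (avgOp L (fine n M) T') u' →
      ∑ ν, dirUv (fine L (fine n M)) R' u' ν ≤ ∑ ν, dirUv (fine L (fine n M)) R' g ν := by
    intro g hg
    have hg' : Qkv n M T (Q1v n L M T' g) = ψ₀ := by
      have : Qkv n M T (Q1v n L M T' g) = Qkv n M T (Q1v n L M T' u') := hg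
      rw [this, hu']
    have h := hu'min g hg'
    unfold Sfv at h
    exact le_of_mul_le_mul_left h hcS
  -- the lattice-unit inequality (§2)
  have hmain := sqrt_projG_le n L M (Rc := Rc) (T := T) (R' := R') hT' W V hu'min'
  -- HARM-APPROX for the third term
  have hH := (harmApprox_colour n L M hT' hRc hR' hm hmis hm₁ hin hcross hΛ hCP hCR hUBc hUBf hPc hPf hREG rfl hsmin hu' hu'min).2
  -- the datum size: `n²·nsqv ψ₀ ≤ cc·divSq W`
  have hψ : nsqv ψ₀ ≤ ((n : ℝ) ^ d)⁻¹ * divSq (fine n M) Rc W := by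
    have h1 : nsqv ψ₀ ≤ qWv n M s₀ := nsqv_Qkv_le n M (fun x => norm_le_one_of_mem_unitary (hT x)) s₀
    have h2 : nsqv s₀ ≤ divSq (fine n M) Rc W := by
      have e : nsqv s₀ = ‖(sliceSub (fine n M) Rc (LinearMap.ker (avgOp n M T)))ᗮ.starProjection (toLp 2 (divV (fine n M) Rc W))‖ ^ 2 := by
        have e' : nsqv s₀ = ‖toLp 2 s₀‖ ^ 2 := by rw [norm_toLp_sq]; rfl
        rw [e']
      rw [e]
      calc _ ≤ ‖toLp 2 (divV (fine n M) Rc W)‖ ^ 2 := pow_le_pow_left₀ (norm_nonneg _) (Submodule.norm_starProjection_apply_le _ _) 2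
        _ = divSq (fine n M) Rc W := by rw [norm_toLp_sq]; rfl
    calc nsqv ψ₀ ≤ qWv n M s₀ := h1
      _ = ((n : ℝ) ^ d)⁻¹ * nsqv s₀ := rfl
      _ ≤ _ := mul_le_mul_of_nonneg_left h2 (by positivity)
  -- third term in END units
  have ht3 : Real.sqrt cf * (((L : ℝ))⁻¹ * Real.sqrt (∑ x, ‖interpv L (fine n M) T' Rc s₀ x - u' x‖ ^ 2))
      ≤ Real.sqrt (CP * eH * (cc * divSq (fine n M) Rc W)) := by
    have e1 : ∑ x, ‖interpv L (fine n M) T' Rc s₀ x - u' x‖ ^ 2 = nsqv (j - u') := by unfold nsqv; rfl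
    have e2 : Real.sqrt cf * (((L : ℝ))⁻¹ * Real.sqrt (nsqv (j - u')))
        = Real.sqrt ((n : ℝ) ^ 2 * qVv n L M (j - u')) := by
      have hx : cf * (((L : ℝ))⁻¹ * Real.sqrt (nsqv (j - u'))) ^ 2 = (n : ℝ) ^ 2 * qVv n L M (j - u') := by
        rw [mul_pow, Real.sq_sqrt (nsqv_nonneg _)]
        unfold qVv
        simp only [cf]
        rw [mul_pow]
        field_simp
      rw [← hx, Real.sqrt_mul hcf, Real.sqrt_sq (by positivity)]
    rw [e1, e2]
    refine Real.sqrt_le_sqrt ?_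
    calc (n : ℝ) ^ 2 * qVv n L M (j - u') ≤ (n : ℝ) ^ 2 * (CP * (eH * nsqv ψ₀)) := mul_le_mul_of_nonneg_left hH (sq_nonneg _)
      _ = CP * eH * ((n : ℝ) ^ 2 * nsqv ψ₀) := by ring
      _ ≤ CP * eH * ((n : ℝ) ^ 2 * (((n : ℝ) ^ d)⁻¹ * divSq (fine n M) Rc W)) := by
          have heH : 0 ≤ eH := by positivity
          exact mul_le_mul_of_nonneg_left (mul_le_mul_of_nonneg_left hψ (sq_nonneg _)) (mul_nonneg hCP heH)
      _ = CP * eH * (cc * divSq (fine n M) Rc W) := by simp only [cc]; ring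
  -- second term in END units: `√cf · L⁻¹ · √(L^d) = √cc`
  have hcoef : Real.sqrt cf * (((L : ℝ))⁻¹ * Real.sqrt ((L : ℝ) ^ d)) = Real.sqrt cc := by
    have hx : cf * (((L : ℝ))⁻¹ * Real.sqrt ((L : ℝ) ^ d)) ^ 2 = cc := by
      rw [mul_pow, Real.sq_sqrt (by positivity)]
      simp only [cf, cc]
      rw [mul_pow]
      field_simp
    rw [← hx, Real.sqrt_mul hcf, Real.sqrt_sq (by positivity)]
  have ht2 : Real.sqrt cf * (((L : ℝ))⁻¹ * (Real.sqrt ((L : ℝ) ^ d) * (Real.sqrt (projG (fine n M) Rc (LinearMap.ker (avgOp n M T)) W)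
        + Real.sqrt ((d : ℝ) / 4) * Real.sqrt (∑ y, ∑ μ, ‖cDv (fine n M) Rc (divV (fine n M) Rc W - s₀) y μ‖ ^ 2))))
      = Real.sqrt (cc * projG (fine n M) Rc (LinearMap.ker (avgOp n M T)) W)
        + Real.sqrt ((d : ℝ) / 4) * Real.sqrt (cc * ∑ y, ∑ μ, ‖cDv (fine n M) Rc (divV (fine n M) Rc W - s₀) y μ‖ ^ 2) := by
    rw [Real.sqrt_mul hcc, Real.sqrt_mul hcc, ← hcoef]
    ring
  -- first term
  have ht1 : Real.sqrt cf * Real.sqrt (∑ x, ‖divV (fine L (fine n M)) R' V x - ((L : ℂ))⁻¹ • interpv L (fine n M) T' Rc (divV (fine n M) Rc W) x‖ ^ 2)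
      = Real.sqrt (cf * ∑ x, ‖divV (fine L (fine n M)) R' V x - ((L : ℂ))⁻¹ • interpv L (fine n M) T' Rc (divV (fine n M) Rc W) x‖ ^ 2) := by
    rw [Real.sqrt_mul hcf]
  -- assemble
  have h := mul_le_mul_of_nonneg_left hmain (Real.sqrt_nonneg cf)
  rw [← Real.sqrt_mul hcf] at h
  refine h.trans ?_
  rw [mul_add, mul_add, ht1, ht2]
  linarith [ht3]

omit [NeZero n] [NeZero L] hM [NormedAddCommGroup E] [InnerProductSpace ℂ E] [CompleteSpace E] [FiniteDimensional ℂ E] in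
/-- `(√a + x)² ≤ (1 + t)·a + (1 + t⁻¹)·x²` for `t > 0` (`2√a·x ≤ t·a + x²∕t`). [folklore] -/
theorem sq_sqrt_add_le_param {a x t : ℝ} (ha : 0 ≤ a) (ht : 0 < t) :
    (Real.sqrt a + x) ^ 2 ≤ (1 + t) * a + (1 + t⁻¹) * x ^ 2 := by
  have hsa : Real.sqrt a ^ 2 = a := Real.sq_sqrt ha
  have h := sq_nonneg (t * Real.sqrt a - x)
  have key : 2 * Real.sqrt a * x ≤ t * a + t⁻¹ * x ^ 2 := by
    have e : t * (t * a + t⁻¹ * x ^ 2) = (t * Real.sqrt a) ^ 2 + x ^ 2 := by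
      rw [mul_pow, hsa]; field_simp
    have h2 : t * (2 * Real.sqrt a * x) ≤ t * (t * a + t⁻¹ * x ^ 2) := by rw [e]; nlinarith [h]
    exact le_of_mul_le_mul_left h2 ht
  nlinarith [key, hsa]

omit [NeZero n] [NeZero L] hM [NormedAddCommGroup E] [InnerProductSpace ℂ E] [CompleteSpace E] [FiniteDimensional ℂ E] in
/-- the real-arithmetic step from the square-root shape to the additive shape: `√P ≤ √X₁ + √A + c√X₂ + √X₃` ⟹
`P ≤ A + (t·A + 3(1+t⁻¹)(X₁ + c²X₂ + X₃))`. [folklore] -/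
theorem le_add_of_sqrt_le {P A X₁ X₂ X₃ c t : ℝ} (hP : 0 ≤ P) (hA : 0 ≤ A) (hX₁ : 0 ≤ X₁) (hX₂ : 0 ≤ X₂) (hX₃ : 0 ≤ X₃) (hc : 0 ≤ c)
    (ht : 0 < t) (h : Real.sqrt P ≤ Real.sqrt X₁ + Real.sqrt A + c * Real.sqrt X₂ + Real.sqrt X₃) :
    P ≤ A + (t * A + 3 * (1 + t⁻¹) * (X₁ + c ^ 2 * X₂ + X₃)) := by
  set x := Real.sqrt X₁ + c * Real.sqrt X₂ + Real.sqrt X₃ with hx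
  have hx0 : 0 ≤ x := by positivity
  have h' : Real.sqrt P ≤ Real.sqrt A + x := by rw [hx]; linarith
  have h1 : P ≤ (Real.sqrt A + x) ^ 2 := by
    rw [← Real.sq_sqrt hP]; exact pow_le_pow_left₀ (Real.sqrt_nonneg _) h' 2
  have h2 := sq_sqrt_add_le_param (x := x) hA ht
  have h3 : x ^ 2 ≤ 3 * (X₁ + c ^ 2 * X₂ + X₃) := by
    have h : (Real.sqrt X₁ + c * Real.sqrt X₂ + Real.sqrt X₃) ^ 2 ≤ 3 * (Real.sqrt X₁ ^ 2 + (c * Real.sqrt X₂) ^ 2 + Real.sqrt X₃ ^ 2) := by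
      nlinarith [sq_nonneg (Real.sqrt X₁ - c * Real.sqrt X₂), sq_nonneg (c * Real.sqrt X₂ - Real.sqrt X₃), sq_nonneg (Real.sqrt X₁ - Real.sqrt X₃)]
    rw [Real.sq_sqrt hX₁, Real.sq_sqrt hX₃, mul_pow, Real.sq_sqrt hX₂] at h
    rw [hx]; exact h
  have ht1 : 0 ≤ 1 + t⁻¹ := by positivity
  nlinarith [mul_le_mul_of_nonneg_left h3 ht1]

/-- **V-ONE-G IN THE ADDITIVE (G′) SHAPE OF FILE 1's `hONEm_of_curl_oneG(_repair)`**: for every `t > 0`,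
`c_f·G′ V ≤ c_c·G W + [ t·c_c·G W + 3(1 + t⁻¹)·( c_f·DIV + (d∕4)·c_c·Σ‖D(div W − s₀)‖² + C_P e_H·c_c·divSq W ) ]`
— and `c_c·G W ≤ ScV Rc G W` (the `G`-part of the action), so the bracket is `ε_G·ρ_G W` with `ρ_G := ScV Rc G W + (the three raw sizes)`, V-REG for the
`ScV` summand being trivial.  The assembler chooses `t = t_k → 0` (e.g. `θ^{k∕2}`) to keep `Σ_k ε_G,k < ∞`. [folklore] -/
theorem oneG_le_add {Rc : Tor (fine n M) → Fin d → (E →L[ℂ] E)} {R' : Tor (fine L (fine n M)) → Fin d → (E →L[ℂ] E)}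
    {T : Tor (fine n M) → (E →L[ℂ] E)} {T' : Tor (fine L (fine n M)) → (E →L[ℂ] E)}
    (hT : ∀ x, T x ∈ unitary (E →L[ℂ] E)) (hT' : ∀ x, T' x ∈ unitary (E →L[ℂ] E)) (hRc : ∀ y μ, Rc y μ ∈ unitary (E →L[ℂ] E))
    (hR' : ∀ x μ, ‖R' x μ‖ ≤ 1)
    {m : ℝ} (hm : 0 ≤ m) (hmis : ∀ y μ j, ‖misv L (fine n M) Rc R' T' y μ j‖ ≤ m)
    {m₁ : ℝ} (hm₁ : 0 ≤ m₁)
    (hin : ∀ (y : Tor (fine n M)) (j : Fin d → Fin L) (μ : Fin d), (j μ : ℕ) + 1 < L →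
      ‖R' (bpt L (fine n M) y j) μ * star (T' (bpt L (fine n M) y j + unitVec (fine L (fine n M)) μ)) - star (T' (bpt L (fine n M) y j))‖ ≤ m₁)
    (hcross : ∀ (y : Tor (fine n M)) (j : Fin d → Fin L) (μ : Fin d), (j μ : ℕ) + 1 = L →
      ‖R' (bpt L (fine n M) y j) μ * star (T' (bpt L (fine n M) y j + unitVec (fine L (fine n M)) μ))
        - star (T' (bpt L (fine n M) y j)) * Rc y μ‖ ≤ m₁)
    {Λ CP CR : ℝ} (hΛ : 0 ≤ Λ) (hCP : 0 ≤ CP) (hCR : 0 ≤ CR)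
    (hUBc : ∀ ψ : Tor M → E, ∃ f, Qkv n M T f = ψ ∧ Scv n M Rc f ≤ Λ * nsqv ψ)
    (hUBf : ∀ ψ : Tor M → E, ∃ g, Qkv n M T (Q1v n L M T' g) = ψ ∧ Sfv n L M R' g ≤ Λ * nsqv ψ)
    (hPc : ∀ f, qWv n M f ≤ CP * (Scv n M Rc f + nsqv (Qkv n M T f)))
    (hPf : ∀ g, qVv n L M g ≤ CP * (Sfv n L M R' g + nsqv (Qkv n M T (Q1v n L M T' g))))
    (hREG : ∀ (ψ : Tor M → E) f, Qkv n M T f = ψ → (∀ f₂, Qkv n M T f₂ = ψ → Scv n M Rc f ≤ Scv n M Rc f₂) →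
      rhov n M Rc f ≤ CR * (Scv n M Rc f + nsqv ψ))
    (W : Tor (fine n M) → Fin d → E) (V : Tor (fine L (fine n M)) → Fin d → E) {t : ℝ} (ht : 0 < t) :
    let ε₁ : ℝ := ((d : ℝ) / 4 + 1 / 2) * ((L : ℝ) / (n : ℝ) ^ 2)
    let δ' : ℝ := Real.sqrt (2 * d * (1 + (d : ℝ) ^ 2)) * ((n : ℝ) * L * m₁)
    let δ : ℝ := Real.sqrt d * ((n : ℝ) * m)
    let eH : ℝ := ε₁ * CR * (Λ + 1) + 2 * δ' * Real.sqrt ((Λ + ε₁ * CR * (Λ + 1)) * (CP * (Λ + 1))) + δ' ^ 2 * (CP * (Λ + 1))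
      + 2 * δ * Real.sqrt (Λ * (CP * (Λ + 1)))
    let s₀ : Tor (fine n M) → E := WithLp.ofLp ((sliceSub (fine n M) Rc (LinearMap.ker (avgOp n M T)))ᗮ.starProjection (toLp 2 (divV (fine n M) Rc W)))
    let cf : ℝ := (((n : ℝ) * L) ^ d)⁻¹ * ((n : ℝ) * L) ^ 2
    let cc : ℝ := ((n : ℝ) ^ d)⁻¹ * (n : ℝ) ^ 2
    cf * projG (fine L (fine n M)) R' (LinearMap.ker ((avgOp n M T).comp (avgOp L (fine n M) T'))) V
      ≤ cc * projG (fine n M) Rc (LinearMap.ker (avgOp n M T)) W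
        + (t * (cc * projG (fine n M) Rc (LinearMap.ker (avgOp n M T)) W)
          + 3 * (1 + t⁻¹) * (cf * ∑ x, ‖divV (fine L (fine n M)) R' V x - ((L : ℂ))⁻¹ • interpv L (fine n M) T' Rc (divV (fine n M) Rc W) x‖ ^ 2
            + (Real.sqrt ((d : ℝ) / 4)) ^ 2 * (cc * ∑ y, ∑ μ, ‖cDv (fine n M) Rc (divV (fine n M) Rc W - s₀) y μ‖ ^ 2)
            + CP * eH * (cc * divSq (fine n M) Rc W))) := by
  intro ε₁ δ' δ eH s₀ cf cc
  have h := sqrt_oneG_le n L M hT hT' hRc hR' hm hmis hm₁ hin hcross hΛ hCP hCR hUBc hUBf hPc hPf hREG W V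
  have hn0 : (0 : ℝ) < n := by exact_mod_cast Nat.pos_of_ne_zero (NeZero.ne n)
  have hL0 : (0 : ℝ) < L := by exact_mod_cast Nat.pos_of_ne_zero (NeZero.ne L)
  have heH : 0 ≤ eH := by positivity
  refine le_add_of_sqrt_le ?_ ?_ ?_ ?_ ?_ (Real.sqrt_nonneg _) ht h
  · have := projG_nonneg (fine L (fine n M)) R' (LinearMap.ker ((avgOp n M T).comp (avgOp L (fine n M) T'))) V; positivity
  · have := projG_nonneg (fine n M) Rc (LinearMap.ker (avgOp n M T)) W; positivity
  · positivity
  · positivity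
  · have := divSq_nonneg (fine n M) Rc W; positivity

end OneG


end Summit.QuantumFields.BalabanUV.T4Continuum.VariationalVectorOneG

end
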